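import Mathlib
import HarnessLib
import Literature.MathematicalPhysics.QuantumFieldTheory.Sweep1
import Summits.QuantumFields.YangMills.Theorems.PencilRigidityCurvatureKernelBoundSwapHankelLogConvex

/-!
# `CurvatureKernelBound` — brick `SwapFormCauchySchwarz` of lead c10's swap-mirror programme toward `Stub.FiniteCouplingStrongSubextensive`
# (crux stmt-QuantumFields-11687, line `coupling-trichotomy`, skeleton v9, wave 2)

Cauchy–Schwarz for the centred reflection-positive form of the coordinate-swap mirror in the
infinite-volume limit.

Write `Θ U = fun e => U (e.1 ∘ swap i j, swap i j e.2)` on gauge configurations of `ℤ⁴`.  Assume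
finite-volume reflection positivity `0 ≤ ⟨Y · Y ∘ Θ⟩_{Λ_L,β}` for bounded measurable local
observables `Y` living in the closed half space `{x j ≤ x i}` (hypothesis `hRP`), `Θ`-invariance
of the finite-volume states `⟨F ∘ Θ⟩_{Λ_L,β} = ⟨F⟩_{Λ_L,β}` (hypothesis `hΘ`), two bounded
measurable local observables `X, Y` in that half space, and box limits `⟨X⟩ → x̄`, `⟨Y⟩ → ȳ`,
`⟨X · X ∘ Θ⟩ → pXX`, `⟨Y · Y ∘ Θ⟩ → pYY`, `⟨X · Y ∘ Θ⟩ → pXY`.  Then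
`(pXY - x̄ ȳ)² ≤ (pXX - x̄²) (pYY - ȳ²)`.

Proof: feed the pencil `Z_t = (X - x̄) + t (Y - ȳ)` into `hRP`; linearity of the finite-volume
expectation (a probability measure, or the zero measure for a degenerate normalisation, in which
case the expanded form is `(x̄ + t ȳ)² ≥ 0`) together with `hΘ` (which gives `⟨X ∘ Θ⟩ = ⟨X⟩`,
`⟨Y ∘ Θ⟩ = ⟨Y⟩` and the symmetry `⟨Y · X ∘ Θ⟩ = ⟨X · Y ∘ Θ⟩`, as `Θ ∘ Θ = id`) expands
`⟨Z_t · Z_t ∘ Θ⟩`, the five box limits pass to `L → ∞`, and the resulting nonnegative quadratic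
polynomial in `t` has nonpositive discriminant (`discrim_le_zero`).
-/

noncomputable section

open scoped BigOperators Topology
open MeasureTheory Filter Set
open Literature.MathematicalPhysics.QuantumLattice Literature.MathematicalPhysics.QuantumFieldTheory
  Literature.Probability.LatticeModels

namespace Summit.QuantumFields.YangMills.Theorems.CurvatureKernel

/-- The swap mirror `U ↦ Θ U`, `Θ U e = U (e.1 ∘ swap i j, swap i j e.2)`, is measurable for the
product `σ`-algebra (precomposition with an edge map). [folklore] -/
theorem measurable_swapConfig {G : Type*} [MeasurableSpace G] (i j : Fin 4) :
    Measurable (fun U : ZdGaugeConfig 4 G =>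
      fun e : Literature.MathematicalPhysics.QuantumLattice.ZdEdge 4 =>
        U (e.1 ∘ Equiv.swap i j, Equiv.swap i j e.2)) :=
  measurable_pi_lambda _ fun _ => measurable_pi_apply _

/-- The swap mirror is an involution on configurations: `Θ (Θ U) = U`. [folklore] -/
theorem swapConfig_swapConfig {G : Type*} (i j : Fin 4) (U : ZdGaugeConfig 4 G) :
    (fun e : Literature.MathematicalPhysics.QuantumLattice.ZdEdge 4 =>
      U ((e.1 ∘ Equiv.swap i j) ∘ Equiv.swap i j, Equiv.swap i j (Equiv.swap i j e.2))) = U := by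
  funext e
  simp only [Function.comp_def, Equiv.swap_apply_self, Prod.mk.eta]

/-- Bilinear expansion of the centred reflection form along the pencil `(X - x̄) + t (Y - ȳ)`
against a probability measure, for bounded measurable `X, Y` and a measurable map `Θ`. [folklore] -/
theorem integral_centredPencil_mul_comp {Ω : Type*} [MeasurableSpace Ω] {μ : Measure Ω}
    [IsProbabilityMeasure μ] {Θ : Ω → Ω} (hΘm : Measurable Θ) {X Y : Ω → ℝ}
    (hX : Measurable X) (hY : Measurable Y) {CX CY : ℝ} (hCX : ∀ ω, |X ω| ≤ CX)
    (hCY : ∀ ω, |Y ω| ≤ CY) (xb yb t : ℝ) :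
    ∫ ω, (X ω - xb + t * (Y ω - yb)) * (X (Θ ω) - xb + t * (Y (Θ ω) - yb)) ∂μ =
      ∫ ω, X ω * X (Θ ω) ∂μ + t * ∫ ω, X ω * Y (Θ ω) ∂μ + t * ∫ ω, Y ω * X (Θ ω) ∂μ +
        t ^ 2 * ∫ ω, Y ω * Y (Θ ω) ∂μ - (xb + t * yb) * ∫ ω, X ω ∂μ -
        (xb + t * yb) * ∫ ω, X (Θ ω) ∂μ - (xb + t * yb) * t * ∫ ω, Y ω ∂μ -
        (xb + t * yb) * t * ∫ ω, Y (Θ ω) ∂μ + (xb + t * yb) ^ 2 := by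
  have hInt : ∀ f : Ω → ℝ, Measurable f → ∀ K : ℝ, (∀ ω, |f ω| ≤ K) → Integrable f μ :=
    fun f hf K hK => Integrable.of_bound hf.aestronglyMeasurable K
      (ae_of_all _ fun ω => by rw [Real.norm_eq_abs]; exact hK ω)
  have hmul : ∀ f g : Ω → ℝ, Measurable f → Measurable g → ∀ Kf Kg : ℝ, (∀ ω, |f ω| ≤ Kf) →
      (∀ ω, |g ω| ≤ Kg) → Integrable (fun ω => f ω * g (Θ ω)) μ :=
    fun f g hf hg Kf Kg hKf hKg => hInt _ (hf.mul (hg.comp hΘm)) (Kf * Kg) fun ω => by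
      rw [abs_mul]
      exact mul_le_mul (hKf ω) (hKg _) (abs_nonneg _) ((abs_nonneg _).trans (hKf ω))
  have i1 : Integrable (fun ω => X ω * X (Θ ω)) μ := hmul X X hX hX CX CX hCX hCX
  have i2 : Integrable (fun ω => t * (X ω * Y (Θ ω))) μ :=
    (hmul X Y hX hY CX CY hCX hCY).const_mul t
  have i3 : Integrable (fun ω => t * (Y ω * X (Θ ω))) μ :=
    (hmul Y X hY hX CY CX hCY hCX).const_mul t
  have i4 : Integrable (fun ω => t ^ 2 * (Y ω * Y (Θ ω))) μ :=
    (hmul Y Y hY hY CY CY hCY hCY).const_mul _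
  have i5 : Integrable (fun ω => (xb + t * yb) * X ω) μ := (hInt X hX CX hCX).const_mul _
  have i6 : Integrable (fun ω => (xb + t * yb) * X (Θ ω)) μ :=
    (hInt (fun ω => X (Θ ω)) (hX.comp hΘm) CX fun ω => hCX _).const_mul _
  have i7 : Integrable (fun ω => (xb + t * yb) * t * Y ω) μ := (hInt Y hY CY hCY).const_mul _
  have i8 : Integrable (fun ω => (xb + t * yb) * t * Y (Θ ω)) μ :=
    (hInt (fun ω => Y (Θ ω)) (hY.comp hΘm) CY fun ω => hCY _).const_mul _
  have e : ∀ ω, (X ω - xb + t * (Y ω - yb)) * (X (Θ ω) - xb + t * (Y (Θ ω) - yb)) =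
      X ω * X (Θ ω) + t * (X ω * Y (Θ ω)) + t * (Y ω * X (Θ ω)) + t ^ 2 * (Y ω * Y (Θ ω))
        - (xb + t * yb) * X ω - (xb + t * yb) * X (Θ ω) - (xb + t * yb) * t * Y ω
        - (xb + t * yb) * t * Y (Θ ω) + (xb + t * yb) ^ 2 := fun ω => by ring
  simp_rw [e]
  rw [integral_add (((((((i1.fun_add i2).fun_add i3).fun_add i4).sub' i5).sub' i6).sub' i7).sub'
      i8) (integrable_const _),
    integral_sub ((((((i1.fun_add i2).fun_add i3).fun_add i4).sub' i5).sub' i6).sub' i7) i8,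
    integral_sub (((((i1.fun_add i2).fun_add i3).fun_add i4).sub' i5).sub' i6) i7,
    integral_sub ((((i1.fun_add i2).fun_add i3).fun_add i4).sub' i5) i6,
    integral_sub (((i1.fun_add i2).fun_add i3).fun_add i4) i5,
    integral_add ((i1.fun_add i2).fun_add i3) i4, integral_add (i1.fun_add i2) i3,
    integral_add i1 i2, integral_const_mul, integral_const_mul, integral_const_mul,
    integral_const_mul, integral_const_mul, integral_const_mul, integral_const_mul,
    integral_const, probReal_univ, one_smul]

/-- **Cauchy–Schwarz for the centred swap-reflection form in the infinite-volume limit.** Given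
finite-volume reflection positivity `0 ≤ ⟨Y · Y ∘ Θ⟩_{box L, β}` for the coordinate swap
`Θ U e = U (e.1 ∘ swap i j, swap i j e.2)` and all bounded measurable observables `Y` depending on
finitely many links in the closed half space `{x j ≤ x i}`, `Θ`-invariance of the finite-volume
states, two bounded measurable observables `X, Y` depending on links `BX, BY` in that half space,
and box limits `⟨X⟩ → x̄`, `⟨Y⟩ → ȳ`, `⟨X · X ∘ Θ⟩ → pXX`, `⟨Y · Y ∘ Θ⟩ → pYY`, `⟨X · Y ∘ Θ⟩ → pXY`,
the centred form satisfies `(pXY - x̄ ȳ)² ≤ (pXX - x̄²) (pYY - ȳ²)`. [folklore] -/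
theorem SwapFormCauchySchwarz : ∀ (N : ℕ) (G : Type) [Group G] [TopologicalSpace G] [IsTopologicalGroup G] [CompactSpace G] [MeasurableSpace G] [BorelSpace G] (ρ : G →* Matrix (Fin N) (Fin N) ℂ) (i j : Fin 4) (β : ℝ), (∀ (L : ℕ) (Y : Literature.MathematicalPhysics.QuantumFieldTheory.ZdGaugeConfig 4 G → ℝ) (B : Finset (Literature.MathematicalPhysics.QuantumLattice.ZdEdge 4)), Measurable Y → (∃ C : ℝ, ∀ U, |Y U| ≤ C) → DependsOn Y (B : Set (Literature.MathematicalPhysics.QuantumLattice.ZdEdge 4)) → (∀ e ∈ B, e.1 j ≤ e.1 i ∧ (e.1 + Pi.single e.2 (1 : ℤ) : Literature.Probability.LatticeModels.Site 4) j ≤ (e.1 + Pi.single e.2 (1 : ℤ) : Literature.Probability.LatticeModels.Site 4) i) → 0 ≤ Literature.MathematicalPhysics.QuantumFieldTheory.zdExpect ρ β (Literature.Probability.LatticeModels.box 4 L) (fun U => Y U * Y (fun e : Literature.MathematicalPhysics.QuantumLattice.ZdEdge 4 => U (e.1 ∘ Equiv.swap i j, Equiv.swap i j e.2)))) → (∀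 (L : ℕ) (F : Literature.MathematicalPhysics.QuantumFieldTheory.ZdGaugeConfig 4 G → ℝ), Literature.MathematicalPhysics.QuantumFieldTheory.zdExpect ρ β (Literature.Probability.LatticeModels.box 4 L) (fun U => F (fun e : Literature.MathematicalPhysics.QuantumLattice.ZdEdge 4 => U (e.1 ∘ Equiv.swap i j, Equiv.swap i j e.2))) = Literature.MathematicalPhysics.QuantumFieldTheory.zdExpect ρ β (Literature.Probability.LatticeModels.box 4 L) F) → ∀ (X Y : Literature.MathematicalPhysics.QuantumFieldTheory.ZdGaugeConfig 4 G → ℝ), Measurable X → Measurable Y → (∃ C : ℝ, ∀ U, |X U| ≤ C) → (∃ C : ℝ, ∀ U, |Y U| ≤ C) → ∀ (BX BY : Finset (Literature.MathematicalPhysics.QuantumLattice.ZdEdge 4)), DependsOn X (BX : Set (Literature.MathematicalPhysics.QuantumLattice.ZdEdge 4)) → DependsOn Y (BY : Set (Literature.MathematicalPhysics.QuantumLattice.ZdEdge 4)) → (∀ e ∈ BX, e.1 j ≤ e.1 i ∧ (e.1 + Pi.single e.2 (1 : ℤ) : Literature.Probability.LatticeModels.Site 4) j ≤ (e.1 + Pi.single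 e.2 (1 : ℤ) : Literature.Probability.LatticeModels.Site 4) i) → (∀ e ∈ BY, e.1 j ≤ e.1 i ∧ (e.1 + Pi.single e.2 (1 : ℤ) : Literature.Probability.LatticeModels.Site 4) j ≤ (e.1 + Pi.single e.2 (1 : ℤ) : Literature.Probability.LatticeModels.Site 4) i) → ∀ (xb yb pXX pYY pXY : ℝ), Literature.Probability.LatticeModels.HasBoxLimit (fun Λ => Literature.MathematicalPhysics.QuantumFieldTheory.zdExpect ρ β Λ X) xb → Literature.Probability.LatticeModels.HasBoxLimit (fun Λ => Literature.MathematicalPhysics.QuantumFieldTheory.zdExpect ρ β Λ Y) yb → Literature.Probability.LatticeModels.HasBoxLimit (fun Λ => Literature.MathematicalPhysics.QuantumFieldTheory.zdExpect ρ β Λ (fun U => X U * X (fun e : Literature.MathematicalPhysics.QuantumLattice.ZdEdge 4 => U (e.1 ∘ Equiv.swap i j, Equiv.swap i j e.2)))) pXX → Literature.Probability.LatticeModels.HasBoxLimit (fun Λ => Literature.MathematicalPhysics.QuantumFieldTheory.zdExpect ρ β Λ (fun U => Y U * Y (fun e : Literature.MathematicalPhysics.QuantumLattice.ZdEdge 4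 => U (e.1 ∘ Equiv.swap i j, Equiv.swap i j e.2)))) pYY → Literature.Probability.LatticeModels.HasBoxLimit (fun Λ => Literature.MathematicalPhysics.QuantumFieldTheory.zdExpect ρ β Λ (fun U => X U * Y (fun e : Literature.MathematicalPhysics.QuantumLattice.ZdEdge 4 => U (e.1 ∘ Equiv.swap i j, Equiv.swap i j e.2)))) pXY → (pXY - xb * yb) ^ 2 ≤ (pXX - xb ^ 2) * (pYY - yb ^ 2) := by
  intro N G _ _ _ _ _ _ ρ i j β hRP hΘ X Y hXm hYm hXb hYb BX BY hXdep hYdep hBX hBY xb yb pXX pYY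
    pXY hx hy hxx hyy hxy
  obtain ⟨CX, hCX⟩ := hXb
  obtain ⟨CY, hCY⟩ := hYb
  -- the quadratic polynomial `t ↦ lim ⟨Z_t · Z_t ∘ Θ⟩`, `Z_t = (X - x̄) + t (Y - ȳ)`,
  -- is nonnegative
  have hquad : ∀ t : ℝ,
      0 ≤ (pYY - yb ^ 2) * (t * t) + 2 * (pXY - xb * yb) * t + (pXX - xb ^ 2) := by
    intro t
    -- the finite-volume sequence converging to the quadratic form
    have ha : Tendsto (fun L => zdExpect ρ β (box 4 L) (fun U => X U *
          X (fun e : Literature.MathematicalPhysics.QuantumLattice.ZdEdge 4 =>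
            U (e.1 ∘ Equiv.swap i j, Equiv.swap i j e.2))) +
        2 * t * zdExpect ρ β (box 4 L) (fun U => X U *
          Y (fun e : Literature.MathematicalPhysics.QuantumLattice.ZdEdge 4 =>
            U (e.1 ∘ Equiv.swap i j, Equiv.swap i j e.2))) +
        t ^ 2 * zdExpect ρ β (box 4 L) (fun U => Y U *
          Y (fun e : Literature.MathematicalPhysics.QuantumLattice.ZdEdge 4 =>
            U (e.1 ∘ Equiv.swap i j, Equiv.swap i j e.2))) -
        2 * (xb + t * yb) * zdExpect ρ β (box 4 L) X -
        2 * ((xb + t * yb) * t) * zdExpect ρ β (box 4 L) Y + (xb + t * yb) ^ 2) atTop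
        (𝓝 (pXX + 2 * t * pXY + t ^ 2 * pYY - 2 * (xb + t * yb) * xb -
          2 * ((xb + t * yb) * t) * yb + (xb + t * yb) ^ 2)) :=
      ((((hxx.add (hxy.const_mul (2 * t))).add (hyy.const_mul (t ^ 2))).sub
        (hx.const_mul (2 * (xb + t * yb)))).sub (hy.const_mul (2 * ((xb + t * yb) * t)))).add
        tendsto_const_nhds
    have hlim : pXX + 2 * t * pXY + t ^ 2 * pYY - 2 * (xb + t * yb) * xb -
        2 * ((xb + t * yb) * t) * yb + (xb + t * yb) ^ 2 =
        (pYY - yb ^ 2) * (t * t) + 2 * (pXY - xb * yb) * t + (pXX - xb ^ 2) := by ring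
    rw [← hlim]
    refine ge_of_tendsto' ha fun L => ?_
    rcases zdWilsonMeasure_eq_zero_or_isProbabilityMeasure ρ β (box 4 L) with h0 | hprob
    · -- degenerate normalisation: the finite-volume state is the zero measure
      have hE : ∀ f : ZdGaugeConfig 4 G → ℝ, zdExpect ρ β (box 4 L) f = 0 := fun f => by
        simp [zdExpect, h0]
      simp only [hE]
      nlinarith [sq_nonneg (xb + t * yb)]
    · -- probability measure: reflection positivity of the pencil `Z_t = (X - x̄) + t (Y - ȳ)`
      have hZm : Measurable fun U : ZdGaugeConfig 4 G => X U - xb + t * (Y U - yb) :=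
        (hXm.sub_const xb).add ((hYm.sub_const yb).const_mul t)
      have hZb : ∃ C : ℝ, ∀ U : ZdGaugeConfig 4 G, |X U - xb + t * (Y U - yb)| ≤ C := by
        refine ⟨CX + |xb| + |t| * (CY + |yb|), fun U => ?_⟩
        have h1 : |X U - xb| ≤ CX + |xb| := (abs_sub _ _).trans (add_le_add (hCX U) le_rfl)
        have h2 : |Y U - yb| ≤ CY + |yb| := (abs_sub _ _).trans (add_le_add (hCY U) le_rfl)
        refine (abs_add_le _ _).trans ?_
        rw [abs_mul]
        exact add_le_add h1 (mul_le_mul_of_nonneg_left h2 (abs_nonneg t))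
      have hZdep : DependsOn (fun U : ZdGaugeConfig 4 G => X U - xb + t * (Y U - yb))
          ((BX ∪ BY : Finset (Literature.MathematicalPhysics.QuantumLattice.ZdEdge 4)) :
            Set (Literature.MathematicalPhysics.QuantumLattice.ZdEdge 4)) := by
        intro U V hUV
        dsimp only
        rw [hXdep fun e he => hUV e (Finset.mem_coe.2
            (Finset.mem_union_left BY (Finset.mem_coe.1 he))),
          hYdep fun e he => hUV e (Finset.mem_coe.2
            (Finset.mem_union_right BX (Finset.mem_coe.1 he)))]
      have hB : ∀ e ∈ BX ∪ BY, e.1 j ≤ e.1 i ∧ (e.1 + Pi.single e.2 (1 : ℤ) : Site 4) j ≤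
          (e.1 + Pi.single e.2 (1 : ℤ) : Site 4) i := fun e he => by
        rcases Finset.mem_union.1 he with h | h
        · exact hBX e h
        · exact hBY e h
      have hpos := hRP L _ _ hZm hZb hZdep hB
      -- `Θ`-invariance of the finite-volume state: `⟨X ∘ Θ⟩ = ⟨X⟩`, `⟨Y ∘ Θ⟩ = ⟨Y⟩`,
      -- and the symmetry `⟨Y · X ∘ Θ⟩ = ⟨(X · Y ∘ Θ) ∘ Θ⟩ = ⟨X · Y ∘ Θ⟩`
      have e1 : ∫ U, X (fun e : Literature.MathematicalPhysics.QuantumLattice.ZdEdge 4 =>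
            U (e.1 ∘ Equiv.swap i j, Equiv.swap i j e.2))
              ∂(zdWilsonMeasure (d := 4) ρ β (box 4 L)) =
          ∫ U, X U ∂(zdWilsonMeasure (d := 4) ρ β (box 4 L)) := hΘ L X
      have e2 : ∫ U, Y (fun e : Literature.MathematicalPhysics.QuantumLattice.ZdEdge 4 =>
            U (e.1 ∘ Equiv.swap i j, Equiv.swap i j e.2))
              ∂(zdWilsonMeasure (d := 4) ρ β (box 4 L)) =
          ∫ U, Y U ∂(zdWilsonMeasure (d := 4) ρ β (box 4 L)) := hΘ L Y
      have e3 : ∫ U, Y U * X (fun e : Literature.MathematicalPhysics.QuantumLattice.ZdEdge 4 =>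
            U (e.1 ∘ Equiv.swap i j, Equiv.swap i j e.2))
              ∂(zdWilsonMeasure (d := 4) ρ β (box 4 L)) =
          ∫ U, X U * Y (fun e : Literature.MathematicalPhysics.QuantumLattice.ZdEdge 4 =>
            U (e.1 ∘ Equiv.swap i j, Equiv.swap i j e.2))
              ∂(zdWilsonMeasure (d := 4) ρ β (box 4 L)) := by
        have h := hΘ L (fun U => X U *
          Y (fun e : Literature.MathematicalPhysics.QuantumLattice.ZdEdge 4 =>
            U (e.1 ∘ Equiv.swap i j, Equiv.swap i j e.2)))
        simp only [zdExpect, swapConfig_swapConfig] at h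
        rw [← h]
        exact integral_congr_ae (ae_of_all _ fun U => mul_comm _ _)
      have key := integral_centredPencil_mul_comp (μ := zdWilsonMeasure (d := 4) ρ β (box 4 L))
        (measurable_swapConfig i j) hXm hYm hCX hCY xb yb t
      rw [e1, e2, e3] at key
      calc (0 : ℝ) ≤ _ := hpos
        _ = _ := by
          simp only [zdExpect]
          linear_combination key
  have hd := discrim_le_zero hquad
  rw [discrim] at hd
  nlinarith [hd]

end Summit.QuantumFields.YangMills.Theorems.CurvatureKernel

end
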